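import Summits.AtomisticToContinuum.HydrodynamicLimit.Theses.InformationPercolationEngine
import Summits.AtomisticToContinuum.HydrodynamicLimit.Theorems.KickIsotropyInfo.Negative.KickIsotropyInfoFalseOfShieldingBiasPersists

/-!
# `KickFairRelEquilibrium` is false modulo `SubcellClusteringBiasPersists` (negative lemma, crux
stmt-AtomisticToContinuum-14914, route InformationPercolationEngine)

The crux asserts, for EVERY fixed cell size `r > 0` and every `δ > 0`, eventually in `N` and uniformly
over measurable weights `|h| ≤ 1` of the typed coarse past `P_{i,n}` (r-cells + exact velocities of all
spheres at the two flight starts, partner label, the three times), that the compensated kick sum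
`S_h = (ε/(N+1)) Σ_i Σ_{n<cnt_i} h(P_{i,n}) (g(X_{i,n}) − κ_{i,n})`, `κ = E_G[g(X) | σ(P)]` under the
INVARIANT law `G`, has `E_{LG}|S_h| ≤ δ` under the local Gibbs law `LG`.

## Findings of the disprover (refuter-cdisprove-stmt-AtomisticToContinuum-14914-0, 2026-08-16)

* **Typing.** The decl elaborates; `kickFairRelEquilibrium_iff` below repackages its `let`-chain into
  `kickSumRel` / `KickBoundRel` DEFINITIONALLY (`Iff.rfl`), so the negative lemma manipulates the crux
  itself. No junk escape: flows exist at every `0 < σ < 1/2` (`nonempty_flow`, Alexander) and carry the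
  true dynamics on a Liouville-conull good set; `LG ≪ liouville`; `κ` is Mathlib's `condExp` given
  `comap P` (non-junk as soon as `P` is Borel, which the good-set cut provides). Recorded for provers:
  the enumeration `nthCollisionTimeOf` RESTARTS through `sInf ∅ = 0` past the last collision, so the
  summation cut `n < cnt` is `σ(P_{i,n})`-measurable only modulo the event "finitely many collisions of
  `i` in `(0, ∞)`", to be shown `G`-null (recurrence).
* **Mechanism `H` (why the decl as typed — `∀ r ∀ δ ∃ N₀` — is expected to FAIL, class misstated).**
  With pure activity tilt (`a₀` non-constant, `θ₀ ≡ 1`, `u₀ ≡ 0`) one has EXACTLY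
  `dLG/dG = Z⁻¹ ∏_k a₀(x_k(0))`, so `E_{LG}[h(P)(g − κ)] = Z⁻¹ E_G[h(P) · Cov_G(∏_k a₀(x_k(0)), g(X) | σ(P))]`:
  the defect is the `G`-conditional covariance, GIVEN THE TYPED PAST, between the sub-cell activity
  tilt and the kick. Inside an `r`-cell the tilt is `exp(α·(x − x_c))`, `α = ∇ log a₀`; at first order
  in the sub-cell displacement the covariance vanishes (translation covariance of the `ε`-scale kick
  geometry inside the cell, error `O(ε|α| + ℓ/r)`), at SECOND order it survives through the co-location
  of the collision point (density `∝ a₀²` inside the cell) with shielding third bodies (density `∝ a₀`):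
  the conditional intensity of third bodies in the contact shell is enhanced by the clustering factor
  `1 + c₂`, `c₂ = (r²/12)(2α)·α = r²|α|²/6 > 0` (cube cell; `∫ρ³∫ρ ≥ (∫ρ²)²`), under `LG` but not under
  the homogeneous `G` (Lebesgue on the fibre). A third body changes the conditional kick LAW only
  through the `O(φ)` conditional shadow/shield bias `B(P) := κ(P) − ḡ₀(v,w)` (`ḡ₀` the flux mean), so
  `E_{LG}[g | P] − κ(P) = c₂ · B(P) · (1 + o(1)) + O(ε|α| + ℓ/r + Kn)`, `N`-INDEPENDENT at fixed `r`.
  CORRECTION of memo `Cruxes/KickFairRelEquilibrium/Analysis-r1-k1.md` §F3 (which proposed the witness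
  `h ≡ 1`, zonal `g`): by Palm isotropy of the invariant law (`ω` is flux-uniform given the velocities
  of ALL spheres at a collision of a homogeneous Gibbs state), `E_Palm[B(P) | all velocities] = 0`, so
  `h ≡ 1` (or any `h` reading velocities only) sees NOTHING at this order; the weight must read the
  RESOLVED KICK GEOMETRY of the two snapshots — exactly the 13478 shielding weight `shieldWeight`
  (`E_G[h · B] = E_G[h · g] = T = +0.0178 ± 0.0004` per term at `φ = 0.05`, `N`-independent, kit j004861,
  for `g = kickTest`, zero flux mean so `B = κ`). Prediction: `E_{LG} S_h → c₂ · T · εΓτ ≠ 0`, i.e. a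
  relative defect `≈ (r²|∇log a₀|²/6) · 0.018` (`≈ 3·10⁻⁵` at `r|α| = 0.1`, `≈ 3·10⁻³` at `r|α| = 1`):
  false by a hair, at every `σ`, vanishing like `r²` — the repair is the quantifier shape of
  `ContactChaos` (`∀ δ ∃ r₀ ∀ r < r₀ ∃ N₀`, R1) or cells `r_N → 0` with `ε ≪ r_N ≪ N^{-1/6}` (R2, which
  also rescues the line's super-exponential stub, see `Negative/StubEqKickTailFalseOfSubcellModeLD`);
  the witness misses both repairs.
* **Why `H` is not constructible here.** Beyond first flights (weight `≍ N^{-1/3}` of the sum) the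
  sub-cell tilt of `LG_s | P` is the positive-time local-equilibrium fine structure (unproved; it is what
  every proof of the crux would use), and even at `s = 0` a LOWER bound on `E_{LG} S_h` needs the
  collision-rate / Palm–Campbell identities for the deterministic `N`-sphere flow and the three-body
  shielded-flux formula — none in the tree (same standing as `ShieldingBiasPersists`, 13478).

No statement of the route is asserted positively. `H → ¬ KickFairRelEquilibrium` is sorry-free.

Record (2026-08-17, dependency-drift repair): the crux was RETIRED from the route (rev 12, replaced by
`KickFairRelEquilibriumMeso`); the token `KickFairRelEquilibrium` below is since then a file-local
notation for the retired item's statement (see the comment before §1); nothing else changed.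
-/

open MeasureTheory Metric Real Set Filter
open scoped InnerProductSpace ENNReal BigOperators Classical

namespace Summit.AtomisticToContinuum.HydrodynamicLimit.Theorems.KickFairRelEquilibriumNegative

noncomputable section

open Literature.MathematicalPhysics.KineticTheory (T3 V3 hsDiameter localGibbsLaw)
open Literature.Analysis.FluidPDE (HardSphereFlow Config collisionTimesOf flightStart Geometry)
/- **The retired crux, verbatim, as a local notation.** The route decl
`Theses.InformationPercolationEngine.KickFairRelEquilibrium` (stmt-AtomisticToContinuum-14914) was RETIRED
from the route (rev 12, 2026-08-16: replaced by the mesoscopic relative form `KickFairRelEquilibriumMeso`,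
which survives the sub-cell clustering mechanism recorded below); no constant of the old name exists any
more, so the former `open … (KickFairRelEquilibrium)` is replaced by this file-LOCAL NOTATION expanding to
the statement of the retired item, verbatim from its ledger signature (the typed `let`-chain: `ε`, the
geometry `G`, the `r`-cells `q`, the flow `γ`, the collision count `cnt`, the coarse past `P`, the kick
datum `X`, the equilibrium conditional mean `κ`, the compensated kick sum `S`, and the `L¹(LG)` bound).
Every theorem below keeps its text (Theorems files are append-only); `kickFairRelEquilibrium_iff` is
still `Iff.rfl` and the negative lemma's elaborated type carries the retired statement itself
(`quotPrecheck` is off for this one command only: the binder and `let` notations have no precheck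
handler; every name in the body is fully qualified). Dependency-drift repair 2026-08-17. -/
set_option quotPrecheck false in
local notation "KickFairRelEquilibrium" =>
  (∀ (a₀ θ₀ : Literature.MathematicalPhysics.KineticTheory.T3 → ℝ) (u₀ : Literature.MathematicalPhysics.KineticTheory.T3 → Literature.MathematicalPhysics.KineticTheory.V3), Continuous a₀ → Continuous θ₀ → Continuous u₀ → (∀ x, 0 < a₀ x) → (∀ x, 0 < θ₀ x) → ∃ σ₀ : ℝ, 0 < σ₀ ∧ ∀ σ : ℝ, 0 < σ → σ < σ₀ → ∀ Φ : (N : ℕ) → Literature.Analysis.FluidPDE.HardSphereFlow (Literature.Analysis.FluidPDE.Torus.geometry (Fin 3)) (Literature.MathematicalPhysics.KineticTheory.hsDiameter σ N) (N + 1), ∀ τ : ℝ, 0 < τ → ∀ r : ℝ, 0 < r → ∀ g : Literature.MathematicalPhysics.KineticTheory.V3 × Literature.MathematicalPhysics.KineticTheory.V3 × Literature.MathematicalPhysics.KineticTheory.V3 → ℝ, Continuous g → (∃ C : ℝ, ∀ p, |g p| ≤ C) → ∀ δ : ℝ, 0 < δ → ∃ N₀ : ℕ, ∀ N : ℕ,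 N₀ ≤ N → ∀ h : Fin (N + 1) → ℕ → (((Fin (N + 1) → (Fin 3 → ℤ) × Literature.MathematicalPhysics.KineticTheory.V3) × (Fin (N + 1) → (Fin 3 → ℤ) × Literature.MathematicalPhysics.KineticTheory.V3)) × Fin (N + 1)) × (ℝ × ℝ × ℝ) → ℝ, (∀ i n, Measurable (h i n)) → (∀ i n p, |h i n p| ≤ 1) → let ε := Literature.MathematicalPhysics.KineticTheory.hsDiameter σ N; let G : Literature.Analysis.FluidPDE.Geometry (Fin 3) Literature.MathematicalPhysics.KineticTheory.T3 := Literature.Analysis.FluidPDE.Torus.geometry (Fin 3); let q : Literature.MathematicalPhysics.KineticTheory.T3 → (Fin 3 → ℤ) := Literature.Analysis.FluidPDE.Torus.coarseCell r; let γ : Literature.Analysis.FluidPDE.Config (N + 1) (Fin 3) Literature.MathematicalPhysics.KineticTheory.T3 → ℝ → Literature.Analysis.FluidPDE.Config (N + 1) (Fin 3) Literature.MathematicalPhysics.KineticTheory.T3 := fun z s => (Φ N).flow s z; let cnt : Literature.Analysis.FluidPDE.Config (N + 1) (Fin 3) Literature.MathematicalPhysics.KineticTheory.T3 → Fin (N +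 1) → ℕ := fun z i => Set.ncard (Literature.Analysis.FluidPDE.collisionTimesOf G ε (γ z) i ∩ Set.Ioc 0 τ); let P : Literature.Analysis.FluidPDE.Config (N + 1) (Fin 3) Literature.MathematicalPhysics.KineticTheory.T3 → Fin (N + 1) → ℕ → (((Fin (N + 1) → (Fin 3 → ℤ) × Literature.MathematicalPhysics.KineticTheory.V3) × (Fin (N + 1) → (Fin 3 → ℤ) × Literature.MathematicalPhysics.KineticTheory.V3)) × Fin (N + 1)) × (ℝ × ℝ × ℝ) := fun z i n => if z ∈ (Φ N).good then (((Φ N).coarsePastOf q i n z, (Φ N).nthPartnerOf i n z), (Literature.Analysis.FluidPDE.flightStart G ε (γ z) 0 i ((Φ N).nthCollisionTimeOf i n z), Literature.Analysis.FluidPDE.flightStart G ε (γ z) 0 ((Φ N).nthPartnerOf i n z) ((Φ N).nthCollisionTimeOf i n z), (Φ N).nthCollisionTimeOf i n z)) else (((fun _ => (0, 0), fun _ => (0, 0)), 0), (0, 0, 0)); let X : Fin (N + 1) → ℕ → Literature.Analysis.FluidPDE.Config (N + 1) (Fin 3) Literature.MathematicalPhysics.KineticTheory.T3 → Literature.MathematicalPhysics.KineticTheory.V3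 × Literature.MathematicalPhysics.KineticTheory.V3 × Literature.MathematicalPhysics.KineticTheory.V3 := fun i n z => if z ∈ (Φ N).good then (((Φ N).nthRecordOf i n z).impactVec, ((Φ N).nthRecordOf i n z).preVel) else 0; let κ : Fin (N + 1) → ℕ → Literature.Analysis.FluidPDE.Config (N + 1) (Fin 3) Literature.MathematicalPhysics.KineticTheory.T3 → ℝ := fun i n => MeasureTheory.condExp (MeasurableSpace.comap (fun z => P z i n) inferInstance) (Literature.MathematicalPhysics.KineticTheory.localGibbsLaw σ (fun _ => 1) (fun _ => 0) (fun _ => 1) N (Φ N)) (fun z => g (X i n z)); let S : Literature.Analysis.FluidPDE.Config (N + 1) (Fin 3) Literature.MathematicalPhysics.KineticTheory.T3 → ℝ := fun z => ε / (N + 1 : ℝ) * ∑ i : Fin (N + 1), ∑ n ∈ Finset.range (cnt z i), h i n (P z i n) * (g (X i n z) - κ i n z); ∫⁻ z, ENNReal.ofReal |S z| ∂(Literature.MathematicalPhysics.KineticTheory.localGibbsLaw σ a₀ u₀ θ₀ N (Φ N)) ≤ ENNReal.ofReal δ)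
open Summit.AtomisticToContinuum.HydrodynamicLimit.Theorems.KickIsotropyInfoNegative
  (Past Flow nonempty_flow kickTest continuous_kickTest abs_kickTest_le_one shieldWeight
    abs_shieldWeight_le_one measurable_shieldWeight)

/-! ## §1 The crux, repackaged (definitionally) -/

/-- The typed coarse past of `KickFairRelEquilibrium`: the 13478 past (r-cells and exact velocities
of all spheres at the two flight starts, partner label) together with the three times
`(s_i, s_q, t_{i,n})`. -/
abbrev PastRel (N : ℕ) : Type := Past N × (ℝ × ℝ × ℝ)

/-- The compensated (equilibrium-centred) kick sum `S_h` of the crux — its `let`-chain verbatim. -/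
def kickSumRel (σ : ℝ) (N : ℕ) (Φ : Flow σ N) (τ r : ℝ) (g : V3 × V3 × V3 → ℝ)
    (h : Fin (N + 1) → ℕ → PastRel N → ℝ) (z : Config (N + 1) (Fin 3) T3) : ℝ :=
  let ε := hsDiameter σ N
  let G : Geometry (Fin 3) T3 := Literature.Analysis.FluidPDE.Torus.geometry (Fin 3)
  let q : T3 → (Fin 3 → ℤ) := Literature.Analysis.FluidPDE.Torus.coarseCell r
  let γ : Config (N + 1) (Fin 3) T3 → ℝ → Config (N + 1) (Fin 3) T3 := fun z s => Φ.flow s z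
  let cnt : Config (N + 1) (Fin 3) T3 → Fin (N + 1) → ℕ := fun z i =>
    Set.ncard (collisionTimesOf G ε (γ z) i ∩ Set.Ioc 0 τ)
  let P : Config (N + 1) (Fin 3) T3 → Fin (N + 1) → ℕ →
      (((Fin (N + 1) → (Fin 3 → ℤ) × V3) × (Fin (N + 1) → (Fin 3 → ℤ) × V3)) × Fin (N + 1)) ×
        (ℝ × ℝ × ℝ) := fun z i n =>
    if z ∈ Φ.good then
      ((Φ.coarsePastOf q i n z, Φ.nthPartnerOf i n z),
        (flightStart G ε (γ z) 0 i (Φ.nthCollisionTimeOf i n z),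
          flightStart G ε (γ z) 0 (Φ.nthPartnerOf i n z) (Φ.nthCollisionTimeOf i n z),
          Φ.nthCollisionTimeOf i n z))
    else (((fun _ => (0, 0), fun _ => (0, 0)), 0), (0, 0, 0))
  let X : Fin (N + 1) → ℕ → Config (N + 1) (Fin 3) T3 → V3 × V3 × V3 := fun i n z =>
    if z ∈ Φ.good then ((Φ.nthRecordOf i n z).impactVec, (Φ.nthRecordOf i n z).preVel) else 0
  let κ : Fin (N + 1) → ℕ → Config (N + 1) (Fin 3) T3 → ℝ := fun i n =>
    MeasureTheory.condExp (MeasurableSpace.comap (fun z => P z i n) inferInstance)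
      (localGibbsLaw σ (fun _ => 1) (fun _ => 0) (fun _ => 1) N Φ) (fun z => g (X i n z))
  ε / (N + 1 : ℝ) * ∑ i : Fin (N + 1), ∑ n ∈ Finset.range (cnt z i),
    h i n (P z i n) * (g (X i n z) - κ i n z)

/-- The conclusion of the crux for given data: `‖S_h‖_{L¹(local Gibbs law)} ≤ δ`. -/
def KickBoundRel (σ : ℝ) (a₀ θ₀ : T3 → ℝ) (u₀ : T3 → V3) (N : ℕ) (Φ : Flow σ N) (τ r : ℝ)
    (g : V3 × V3 × V3 → ℝ) (h : Fin (N + 1) → ℕ → PastRel N → ℝ) (δ : ℝ) : Prop :=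
  ∫⁻ z, ENNReal.ofReal |kickSumRel σ N Φ τ r g h z| ∂(localGibbsLaw σ a₀ u₀ θ₀ N Φ) ≤
    ENNReal.ofReal δ

/-- **Faithful restatement.** `KickFairRelEquilibrium` with its `let`-chain packaged into
`kickSumRel` / `KickBoundRel` (definitional unfolding). -/
theorem kickFairRelEquilibrium_iff :
    KickFairRelEquilibrium ↔
      ∀ (a₀ θ₀ : T3 → ℝ) (u₀ : T3 → V3), Continuous a₀ → Continuous θ₀ → Continuous u₀ →
        (∀ x, 0 < a₀ x) → (∀ x, 0 < θ₀ x) → ∃ σ₀ : ℝ, 0 < σ₀ ∧ ∀ σ : ℝ, 0 < σ → σ < σ₀ →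
        ∀ Φ : (N : ℕ) → Flow σ N, ∀ τ : ℝ, 0 < τ → ∀ r : ℝ, 0 < r →
        ∀ g : V3 × V3 × V3 → ℝ, Continuous g → (∃ C : ℝ, ∀ p, |g p| ≤ C) →
        ∀ δ : ℝ, 0 < δ → ∃ N₀ : ℕ, ∀ N : ℕ, N₀ ≤ N →
        ∀ h : Fin (N + 1) → ℕ → PastRel N → ℝ, (∀ i n, Measurable (h i n)) →
        (∀ i n p, |h i n p| ≤ 1) → KickBoundRel σ a₀ θ₀ u₀ N (Φ N) τ r g h δ :=
  Iff.rfl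

/-! ## §2 The witness: tilted activity, the 13478 shielding pair read off the 14914 past -/

/-- The shielding weight of `Negative/KickIsotropyInfoFalseOfShieldingBiasPersists` read off the
14914 past (it ignores the three times). -/
def shieldWeightRel (c : V3 → V3 → V3) (K : ℝ) (N : ℕ) (i : Fin (N + 1)) (n : ℕ) (p : PastRel N) :
    ℝ :=
  shieldWeight c K N i n p.1

/-- The weight is bounded by `1`. [folklore] -/
theorem abs_shieldWeightRel_le_one (c : V3 → V3 → V3) (K : ℝ) (N : ℕ) (i : Fin (N + 1)) (n : ℕ)
    (p : PastRel N) : |shieldWeightRel c K N i n p| ≤ 1 :=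
  abs_shieldWeight_le_one c K N i n p.1

/-- The weight is measurable on the typed past. [folklore] -/
theorem measurable_shieldWeightRel {c : V3 → V3 → V3} (hc : Continuous fun p : V3 × V3 => c p.1 p.2)
    (K : ℝ) (N : ℕ) (i : Fin (N + 1)) (n : ℕ) : Measurable (shieldWeightRel c K N i n) :=
  (measurable_shieldWeight hc K N i n).comp measurable_fst

/-- **The tilted activity** `a₀(x) = 2 + cos(2π x₀)` (a pure density modulation along the first axis
of `𝕋³`; `|∇ log a₀| ≤ 2π`, values in `[1, 3]`). -/
def tiltedActivity (x : T3) : ℝ := 2 + (fourier 1 (x 0) : ℂ).re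

/-- The tilted activity is continuous. [folklore] -/
theorem continuous_tiltedActivity : Continuous tiltedActivity :=
  continuous_const.add (Complex.continuous_re.comp ((fourier 1).continuous.comp (continuous_apply 0)))

/-- The tilted activity is positive (indeed `≥ 1`). [folklore] -/
theorem tiltedActivity_pos (x : T3) : 0 < tiltedActivity x := by
  have h1 : ‖(fourier 1 (x 0) : ℂ)‖ = 1 := by
    rw [fourier_apply, Circle.norm_coe]
  have h2 : |(fourier 1 (x 0) : ℂ).re| ≤ 1 := (Complex.abs_re_le_norm _).trans h1.le
  have h3 : -1 ≤ (fourier 1 (x 0) : ℂ).re := (abs_le.1 h2).1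
  unfold tiltedActivity
  linarith

/-! ## §3 `H` and the negative lemma `H → ¬ KickFairRelEquilibrium` -/

/-- **`H`: the sub-cell clustering bias persists (the dynamical inequality behind the fixed-`r`
defect).** Under the local Gibbs law with the tilted activity `a₀ = 2 + cos(2πx₀)` (`θ₀ ≡ 1`,
`u₀ ≡ 0`): for every `σ₀` there are `σ < σ₀`, a flow family, a horizon `τ`, a FIXED cell size `r`, a
continuous transverse field `c` (`c(v,w) ⊥ w − v`), constants `κ > 0`, `K` and `δ > 0` such that for
infinitely many `N` the `L¹(LG)` norm of the compensated kick sum with kick test `kickTest c κ` and the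
13478 shielding weight `shieldWeightRel c K N` EXCEEDS `δ`. Mechanism (module docstring): the defect is
`Z⁻¹ E_G[h(P) Cov_G(∏_k a₀(x_k(0)), g(X) | σ(P))]`; it is second order in the sub-cell displacement —
the clustering factor `c₂ = r²|∇log a₀|²/6` of the collision point with shielding third bodies — times
the conditional shielding bias `B(P) = κ(P)` that the weight detects (`E_G[h·κ] = +0.0178(4)` per term
at `φ = 0.05`, kit j004861): `E_{LG} S_h → c₂ · 0.018 · εΓτ ≠ 0`, `N`-independent, `∝ r²` (so the
witness misses the repaired decl with `r → 0` before `N → ∞`). NOT CONSTRUCTIBLE in the tree today: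
no collision-rate / Palm–Campbell identity for the `N`-body flow, no three-body shielded-flux formula,
and at positive times the sub-cell tilt of `LG_s | P` is the (unproved) local-equilibrium fine
structure. [topic MathematicalPhysics/KineticTheory] -/
def SubcellClusteringBiasPersists : Prop :=
  ∀ σ₀ : ℝ, 0 < σ₀ → ∃ σ : ℝ, 0 < σ ∧ σ < σ₀ ∧ ∃ Φ : (N : ℕ) → Flow σ N, ∃ τ : ℝ, 0 < τ ∧
    ∃ r : ℝ, 0 < r ∧ ∃ c : V3 → V3 → V3, (Continuous fun p : V3 × V3 => c p.1 p.2) ∧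
    (∀ v w, ⟪c v w, w - v⟫_ℝ = 0) ∧ ∃ κ : ℝ, 0 < κ ∧ ∃ K : ℝ, ∃ δ : ℝ, 0 < δ ∧
    ∀ N₀ : ℕ, ∃ N : ℕ, N₀ ≤ N ∧
      ¬ KickBoundRel σ tiltedActivity (fun _ => 1) (fun _ => 0) N (Φ N) τ r (kickTest c κ)
        (shieldWeightRel c K N) δ

/-- **NEGATIVE LEMMA MODULO `H = SubcellClusteringBiasPersists`: `H → ¬ KickFairRelEquilibrium`.**
The witnesses are admissible (§2: continuous positive profiles, continuous bounded kick test,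
measurable weights bounded by `1`), so the crux's bound would apply to them. -/
theorem KickFairRelEquilibrium_false_of_SubcellClusteringBiasPersists
    (H : SubcellClusteringBiasPersists) : ¬ KickFairRelEquilibrium := by
  intro hK
  obtain ⟨σ₀, hσ₀, hall⟩ := (kickFairRelEquilibrium_iff.1 hK) tiltedActivity (fun _ => 1)
    (fun _ => 0) continuous_tiltedActivity continuous_const continuous_const tiltedActivity_pos
    (fun _ => one_pos)
  obtain ⟨σ, hσ, hσσ₀, Φ, τ, hτ, r, hr, c, hc, -, κ, hκ, K, δ, hδ, hN⟩ := H σ₀ hσ₀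
  obtain ⟨N₀, hN₀⟩ := hall σ hσ hσσ₀ Φ τ hτ r hr (kickTest c κ) (continuous_kickTest hc hκ)
    ⟨1, abs_kickTest_le_one c hκ⟩ δ hδ
  obtain ⟨N, hle, hnot⟩ := hN N₀
  exact hnot (hN₀ N hle (shieldWeightRel c K N) (fun i n => measurable_shieldWeightRel hc K N i n)
    (fun i n p => abs_shieldWeightRel_le_one c K N i n p))

end

end Summit.AtomisticToContinuum.HydrodynamicLimit.Theorems.KickFairRelEquilibriumNegative
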